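import Summits.QuantumFields.YangMills.Theorems.ColdStartUniversalityLatticeLangevinWilsonEntropyProduction
import Literature.Probability.MarkovChains.Hypercontractivity
import HarnessLib

/-!
# Route `ColdStartUniversality` (fixed-cut-off package, `Lᵖ` side): the scale-`h` `L^q` PRODUCTION INEQUALITY of the SZZ
# semigroup — `∫ (κ_h u)^q dμ − ∫ u^q dμ ≤ −(4(q−1)/q)·h𝓔_h(u^{q/2}) + q(q−1)·M·‖κ_h u − u‖²_∞`

Helper file (seat `ym-line-csu-p1`, g36; `--supports stmt-QuantumFields-24809`).  For the SU(2) lattice Langevin dynamics of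
Shen–Zhu–Zhu at `(L, β')`, `μ = μ_{β'}` the Wilson measure, ANY realising kernel family `κ` (reversible w.r.t. `μ`, detailed balance
`map_swap_compProd_transitionKernel`), and the scale-`h` Dirichlet form `h𝓔_h(G) = ∫ G² dμ − ∫ G κ_hG dμ` of the `L²` package, this file is
the `L^q` analogue (`1 < q < ∞`, real exponent, `Real.rpow`) of g21's scale-`h` ENTROPY production inequality
(`…WilsonEntropyProduction`), i.e. the discrete-time form of Gross's differential inequality behind HYPERCONTRACTIVITY:

* ★ `four_mul_sub_one_mul_dirichletScale_rpow_half_le` — the STROOCK–VAROPOULOS inequality at scale `h`: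
  `4(q−1)·(∫ u^{q/2}u^{q/2} dμ − ∫ u^{q/2} κ_h u^{q/2} dμ) ≤ q²·(∫ u·u^{q−1} dμ − ∫ u^{q−1} κ_h u dμ)` for continuous `u > 0`
  (double-integral form `integral_mul_sub_mul_transition_eq_half` of both sides + the pointwise inequality
  `4(q−1)(a^{q/2} − b^{q/2})² ≤ q²(a − b)(a^{q−1} − b^{q−1})` of the tree, `Literature.Probability.MarkovChains.four_mul_sq_rpow_half_sub_le`);
* ★ `integral_rpow_transition_sub_le` — CONVEXITY step: `∫ (κ_h u)^q dμ − ∫ u^q dμ ≤ q ∫ (κ_h u)^{q−1}(κ_h u − u) dμ` (tangent line of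
  `x ↦ x^q`, `q ≥ 1`);
* `sub_mul_rpow_sub_one_sub_le` — pointwise `(a − b)(a^{q−1} − b^{q−1}) ≤ (q−1)·M·(a − b)²` on `[δ, B]` when `ξ^{q−2} ≤ M` there
  (mean value theorem);
* ★★ `integral_rpow_transition_sub_le_dirichletScale` — THE SCALE-`h` `L^q` PRODUCTION INEQUALITY: for continuous `u` with
  `δ ≤ u ≤ B` (`δ > 0`), `|κ_h u − u| ≤ D` and `ξ^{q−2} ≤ M` on `[δ, B]`,
  `∫ (κ_h u)^q dμ − ∫ u^q dμ ≤ −(4(q−1)/q)·(∫ u^{q/2}u^{q/2} dμ − ∫ u^{q/2} κ_h u^{q/2} dμ) + q(q−1)·M·D²`;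
  divided by `h` and read along `u = κ_t F` (`D = h·sup|𝓛F|`) this is `d⁺/dt ‖κ_t F‖_q^q ≤ −(4(q−1)/q) 𝓔((κ_tF)^{q/2})`, the input
  of Gross's theorem (sequel `…Hypercontractivity`).

THEOREMS ONLY, no definition, no sorry.  HONEST FRAMING: RECORD-rung R3 plumbing at FIXED cut-off; nothing K-uniform is proved;
no crux, rung or summit statement is proved; the Yang–Mills mass gap is NOT proved.
-/

set_option autoImplicit false

noncomputable section

namespace Summit.QuantumFields.YangMills.Theorems.ColdStartUniversality

open MeasureTheory ProbabilityTheory Filter Set Topology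
open scoped BigOperators NNReal ENNReal
open Literature.Probability.Process Literature.MathematicalPhysics.QuantumFieldTheory
open Literature.MathematicalPhysics.QuantumLattice (fundamentalRep fundamentalLatticeRep continuous_fundamentalRep)

variable {L : ℕ} [NeZero L]

/-! ## §1. The Stroock–Varopoulos inequality at scale `h` -/

/-- ★ **Stroock–Varopoulos at scale `h`.**  For continuous `u > 0`, any realising kernel family, any `h` and `1 < q`:
`4(q−1)·(∫ u^{q/2}·u^{q/2} dμ_{β'} − ∫ u^{q/2}·κ_h u^{q/2} dμ_{β'}) ≤ q²·(∫ u·u^{q−1} dμ_{β'} − ∫ u^{q−1}·κ_h u dμ_{β'})`,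
i.e. `4(q−1)·𝓔_h(u^{q/2}) ≤ q²·𝓔_h(u, u^{q−1})`: both sides are half double integrals against `μ_{β'} ⊗ κ_h` (detailed balance) of
`4(q−1)(u(x)^{q/2} − u(y)^{q/2})² ≤ q²(u(x) − u(y))(u(x)^{q−1} − u(y)^{q−1})`.
[cite: DiaconisSaloffcoste1996, §2.3 Lemma 2.6 (reversible case)] -/
theorem four_mul_sub_one_mul_dirichletScale_rpow_half_le (L : ℕ) [NeZero L] (β' : ℝ)
    (κ : ℝ≥0 → Kernel (GaugeConfig 3 L (Matrix.specialUnitaryGroup (Fin 2) ℂ))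
      (GaugeConfig 3 L (Matrix.specialUnitaryGroup (Fin 2) ℂ))) [∀ t, IsMarkovKernel (κ t)]
    (hreal : ∀ (t : ℝ≥0) (x : GaugeConfig 3 L (Matrix.specialUnitaryGroup (Fin 2) ℂ))
        (Ω : Type) [MeasurableSpace Ω] (P : Measure Ω) [IsProbabilityMeasure P]
        (W : ℝ≥0 → Ω → (Edge 3 L × NoiseIdx 2 → ℝ)) (hW : IsFlatBrownian W P)
        (U : ℝ≥0 → Ω → GaugeConfig 3 L (Matrix.specialUnitaryGroup (Fin 2) ℂ)),
        (∀ ω, U 0 ω = x) →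
        (latticeLangevinDynamics (fundamentalLatticeRep 2) β').IsSolution (fundamentalRep (Fin 2))
          hW.natFiltration P W U →
        κ t x = P.map (U t))
    (h : ℝ≥0) {u : GaugeConfig 3 L (Matrix.specialUnitaryGroup (Fin 2) ℂ) → ℝ} (hu : Continuous u) (hpos : ∀ x, 0 < u x)
    {q : ℝ} (hq : 1 < q) :
    4 * (q - 1) * ((∫ x, u x ^ (q / 2) * u x ^ (q / 2) ∂(wilsonMeasure (d := 3) (L := L) (fundamentalRep (Fin 2)) β')) -
        ∫ x, u x ^ (q / 2) * (∫ y, u y ^ (q / 2) ∂(κ h x)) ∂(wilsonMeasure (d := 3) (L := L) (fundamentalRep (Fin 2)) β')) ≤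
      q ^ 2 * ((∫ x, u x * u x ^ (q - 1) ∂(wilsonMeasure (d := 3) (L := L) (fundamentalRep (Fin 2)) β')) -
        ∫ x, u x ^ (q - 1) * (∫ y, u y ∂(κ h x)) ∂(wilsonMeasure (d := 3) (L := L) (fundamentalRep (Fin 2)) β')) := by
  classical
  haveI := secondCountableTopology_su2
  haveI := borelSpace_config L
  set μ : Measure (GaugeConfig 3 L (Matrix.specialUnitaryGroup (Fin 2) ℂ)) :=
    wilsonMeasure (d := 3) (L := L) (fundamentalRep (Fin 2)) β' with hμ
  haveI : IsProbabilityMeasure μ :=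
    isProbabilityMeasure_wilsonMeasure (d := 3) (L := L) (fundamentalRep (Fin 2)) (continuous_fundamentalRep (Fin 2)) β'
  haveI : IsProbabilityMeasure (μ ⊗ₘ κ h) := by infer_instance
  -- the two powers are continuous
  have ha : Continuous fun x => u x ^ (q / 2) := hu.rpow_const fun x => Or.inl (hpos x).ne'
  have hb : Continuous fun x => u x ^ (q - 1) := hu.rpow_const fun x => Or.inl (hpos x).ne'
  rw [integral_mul_sub_mul_transition_eq_half L β' κ hreal h ha ha,
    integral_mul_sub_mul_transition_eq_half L β' κ hreal h hu hb]
  -- compare the integrands against `μ ⊗ κ_h`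
  have hc1 : Continuous fun p : GaugeConfig 3 L (Matrix.specialUnitaryGroup (Fin 2) ℂ) ×
      GaugeConfig 3 L (Matrix.specialUnitaryGroup (Fin 2) ℂ) =>
      (u p.1 ^ (q / 2) - u p.2 ^ (q / 2)) * (u p.1 ^ (q / 2) - u p.2 ^ (q / 2)) :=
    ((ha.comp continuous_fst).sub (ha.comp continuous_snd)).mul ((ha.comp continuous_fst).sub (ha.comp continuous_snd))
  have hc2 : Continuous fun p : GaugeConfig 3 L (Matrix.specialUnitaryGroup (Fin 2) ℂ) ×
      GaugeConfig 3 L (Matrix.specialUnitaryGroup (Fin 2) ℂ) => (u p.1 - u p.2) * (u p.1 ^ (q - 1) - u p.2 ^ (q - 1)) :=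
    ((hu.comp continuous_fst).sub (hu.comp continuous_snd)).mul ((hb.comp continuous_fst).sub (hb.comp continuous_snd))
  have i1 := integrable_of_continuous_of_compactSpace hc1 (μ ⊗ₘ κ h)
  have i2 := integrable_of_continuous_of_compactSpace hc2 (μ ⊗ₘ κ h)
  have hmono : ∫ p, 4 * (q - 1) * ((u p.1 ^ (q / 2) - u p.2 ^ (q / 2)) * (u p.1 ^ (q / 2) - u p.2 ^ (q / 2))) ∂(μ ⊗ₘ κ h) ≤
      ∫ p, q ^ 2 * ((u p.1 - u p.2) * (u p.1 ^ (q - 1) - u p.2 ^ (q - 1))) ∂(μ ⊗ₘ κ h) := by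
    refine integral_mono (i1.const_mul _) (i2.const_mul _) fun p => ?_
    have hSV := Literature.Probability.MarkovChains.four_mul_sq_rpow_half_sub_le hq (hpos p.1).le (hpos p.2).le
    simp only [] at hSV ⊢
    nlinarith [hSV]
  rw [integral_const_mul, integral_const_mul] at hmono
  linarith

/-! ## §2. The convexity (tangent-line) step -/

/-- ★ **Convexity step**: for continuous `u > 0`, any realising kernel family, any `h` and `1 ≤ q`,
`∫ (κ_h u)^q dμ_{β'} − ∫ u^q dμ_{β'} ≤ q ∫ (κ_h u)^{q−1}(κ_h u − u) dμ_{β'}` — the tangent-line inequality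
`v^q + q v^{q−1}(u − v) ≤ u^q` of the convex `x ↦ x^q` at `v = κ_h u`, integrated.  (The `Lᵖ` replacement for Gibbs' step
`entropy_transition_sub_entropy_le`.) [cite: DiaconisSaloffcoste1996, §2.3 Lemma 2.5/2.6 (convexity of `t ↦ t^{p/2}`)] -/
theorem integral_rpow_transition_sub_le (L : ℕ) [NeZero L] (β' : ℝ)
    (κ : ℝ≥0 → Kernel (GaugeConfig 3 L (Matrix.specialUnitaryGroup (Fin 2) ℂ))
      (GaugeConfig 3 L (Matrix.specialUnitaryGroup (Fin 2) ℂ))) [∀ t, IsMarkovKernel (κ t)]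
    (hreal : ∀ (t : ℝ≥0) (x : GaugeConfig 3 L (Matrix.specialUnitaryGroup (Fin 2) ℂ))
        (Ω : Type) [MeasurableSpace Ω] (P : Measure Ω) [IsProbabilityMeasure P]
        (W : ℝ≥0 → Ω → (Edge 3 L × NoiseIdx 2 → ℝ)) (hW : IsFlatBrownian W P)
        (U : ℝ≥0 → Ω → GaugeConfig 3 L (Matrix.specialUnitaryGroup (Fin 2) ℂ)),
        (∀ ω, U 0 ω = x) →
        (latticeLangevinDynamics (fundamentalLatticeRep 2) β').IsSolution (fundamentalRep (Fin 2))
          hW.natFiltration P W U →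
        κ t x = P.map (U t))
    (h : ℝ≥0) {u : GaugeConfig 3 L (Matrix.specialUnitaryGroup (Fin 2) ℂ) → ℝ} (hu : Continuous u) (hpos : ∀ x, 0 < u x)
    {q : ℝ} (hq : 1 ≤ q) :
    (∫ x, (∫ y, u y ∂(κ h x)) ^ q ∂(wilsonMeasure (d := 3) (L := L) (fundamentalRep (Fin 2)) β')) -
        ∫ x, u x ^ q ∂(wilsonMeasure (d := 3) (L := L) (fundamentalRep (Fin 2)) β') ≤
      q * ∫ x, (∫ y, u y ∂(κ h x)) ^ (q - 1) * ((∫ y, u y ∂(κ h x)) - u x)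
        ∂(wilsonMeasure (d := 3) (L := L) (fundamentalRep (Fin 2)) β') := by
  classical
  haveI := secondCountableTopology_su2
  haveI := borelSpace_config L
  set μ : Measure (GaugeConfig 3 L (Matrix.specialUnitaryGroup (Fin 2) ℂ)) :=
    wilsonMeasure (d := 3) (L := L) (fundamentalRep (Fin 2)) β' with hμ
  haveI : IsProbabilityMeasure μ :=
    isProbabilityMeasure_wilsonMeasure (d := 3) (L := L) (fundamentalRep (Fin 2)) (continuous_fundamentalRep (Fin 2)) β'
  -- `v = κ_h u` is continuous and positive
  set v : GaugeConfig 3 L (Matrix.specialUnitaryGroup (Fin 2) ℂ) → ℝ := fun x => ∫ y, u y ∂(κ h x) with hv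
  have hvc : Continuous v := continuous_integral_transitionKernel L β' κ hreal h hu
  obtain ⟨δ, hδ, hδle⟩ := exists_pos_le_of_continuous_of_compactSpace hu hpos
  have hvpos : ∀ x, 0 < v x := by
    intro x
    have h1 : δ ≤ ∫ y, u y ∂(κ h x) := by
      have := integral_mono (integrable_const (μ := κ h x) δ) (integrable_of_continuous_of_compactSpace hu _) fun y => hδle y
      rwa [integral_const, probReal_univ, one_smul] at this
    exact lt_of_lt_of_le hδ h1
  -- pointwise tangent line: `v^q − u^q ≤ q v^{q−1} (v − u)` (from the tree's `rpow_half_tangent` at exponent `2q`)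
  have hpt : ∀ x, v x ^ q - u x ^ q ≤ q * (v x ^ (q - 1) * (v x - u x)) := by
    intro x
    have hT := Literature.Probability.MarkovChains.rpow_half_tangent (p := 2 * q) (a := u x) (b := v x) (by linarith)
      (hpos x).le (hvpos x).le
    have e1 : 2 * q / 2 = q := by ring
    rw [e1] at hT
    -- `hT : v^q (v^q − u^q) ≤ q · v^{2q−1} · (v − u)`, and `v^{2q−1} = v^q · v^{q−1}`
    have e2 : v x ^ (2 * q - 1) = v x ^ q * v x ^ (q - 1) := by
      rw [← Real.rpow_add (hvpos x)]; congr 1; ring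
    rw [e2] at hT
    have hvq : 0 < v x ^ q := Real.rpow_pos_of_pos (hvpos x) q
    have hT' : v x ^ q * (v x ^ q - u x ^ q) ≤ v x ^ q * (q * (v x ^ (q - 1) * (v x - u x))) := by
      calc v x ^ q * (v x ^ q - u x ^ q) ≤ 2 * q / 2 * (v x ^ q * v x ^ (q - 1)) * (v x - u x) := by rw [e1]; exact hT
        _ = v x ^ q * (q * (v x ^ (q - 1) * (v x - u x))) := by ring
    exact le_of_mul_le_mul_left hT' hvq
  have hvq : Continuous fun x => v x ^ q := hvc.rpow_const fun x => Or.inl (hvpos x).ne'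
  have huq : Continuous fun x => u x ^ q := hu.rpow_const fun x => Or.inl (hpos x).ne'
  have hvq1 : Continuous fun x => v x ^ (q - 1) := hvc.rpow_const fun x => Or.inl (hvpos x).ne'
  have hrhs : Continuous fun x => v x ^ (q - 1) * (v x - u x) := hvq1.mul (hvc.sub hu)
  have ivq := integrable_of_continuous_of_compactSpace hvq μ
  have iuq := integrable_of_continuous_of_compactSpace huq μ
  have ivu : Integrable (fun x => v x ^ q - u x ^ q) μ := ivq.sub iuq
  have irhs : Integrable (fun x => q * (v x ^ (q - 1) * (v x - u x))) μ :=
    (integrable_of_continuous_of_compactSpace hrhs μ).const_mul q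
  have hm := integral_mono ivu irhs hpt
  rw [integral_sub ivq iuq, integral_const_mul] at hm
  exact hm

/-! ## §3. The Lipschitz bound for `x ↦ x^{q−1}` on `[δ, B]` -/

/-- **Pointwise**: if `0 < δ`, `δ ≤ a, b ≤ B` and `ξ^{q−2} ≤ M` for all `ξ ∈ [δ, B]` (`1 ≤ q`), then
`(a − b)(a^{q−1} − b^{q−1}) ≤ (q−1)·M·(a − b)²` (mean value theorem for `x ↦ x^{q−1}` on `[δ, B]`, whose derivative is
`(q−1)ξ^{q−2}`). [folklore] -/
theorem sub_mul_rpow_sub_one_sub_le {q δ B M a b : ℝ} (hq : 1 ≤ q) (hδ : 0 < δ)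
    (hM : ∀ ξ, δ ≤ ξ → ξ ≤ B → ξ ^ (q - 2) ≤ M) (ha : δ ≤ a) (haB : a ≤ B) (hb : δ ≤ b) (hbB : b ≤ B) :
    (a - b) * (a ^ (q - 1) - b ^ (q - 1)) ≤ (q - 1) * M * (a - b) ^ 2 := by
  -- the mean value bound on `D = [δ, B]`
  have hD : Convex ℝ (Icc δ B) := convex_Icc δ B
  have hcont : ContinuousOn (fun x : ℝ => x ^ (q - 1)) (Icc δ B) := by
    refine ContinuousOn.rpow_const continuousOn_id fun x hx => Or.inl ?_
    exact (lt_of_lt_of_le hδ hx.1).ne'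
  have hdiff : DifferentiableOn ℝ (fun x : ℝ => x ^ (q - 1)) (interior (Icc δ B)) := by
    intro x hx
    rw [interior_Icc] at hx
    exact (Real.hasDerivAt_rpow_const (p := q - 1) (Or.inl (lt_trans hδ hx.1).ne')).differentiableAt.differentiableWithinAt
  have hderiv : ∀ x ∈ interior (Icc δ B), deriv (fun x : ℝ => x ^ (q - 1)) x ≤ (q - 1) * M := by
    intro x hx
    rw [interior_Icc] at hx
    have hx0 : 0 < x := lt_trans hδ hx.1
    rw [(Real.hasDerivAt_rpow_const (p := q - 1) (Or.inl hx0.ne')).deriv]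
    have e : q - 1 - 1 = q - 2 := by ring
    rw [e]
    exact mul_le_mul_of_nonneg_left (hM x hx.1.le hx.2.le) (by linarith)
  have hmvt := hD.image_sub_le_mul_sub_of_deriv_le hcont hdiff hderiv
  rcases le_total b a with hba | hab
  · -- `b ≤ a`: `a^{q−1} − b^{q−1} ≤ (q−1)M(a−b)`, multiply by `a − b ≥ 0`
    have h1 := hmvt b ⟨hb, hbB⟩ a ⟨ha, haB⟩ hba
    have h2 : 0 ≤ a - b := sub_nonneg.2 hba
    calc (a - b) * (a ^ (q - 1) - b ^ (q - 1)) ≤ (a - b) * ((q - 1) * M * (a - b)) :=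
        mul_le_mul_of_nonneg_left h1 h2
      _ = (q - 1) * M * (a - b) ^ 2 := by ring
  · -- `a ≤ b`: symmetric
    have h1 := hmvt a ⟨ha, haB⟩ b ⟨hb, hbB⟩ hab
    have h2 : 0 ≤ b - a := sub_nonneg.2 hab
    calc (a - b) * (a ^ (q - 1) - b ^ (q - 1)) = (b - a) * (b ^ (q - 1) - a ^ (q - 1)) := by ring
      _ ≤ (b - a) * ((q - 1) * M * (b - a)) := mul_le_mul_of_nonneg_left h1 h2
      _ = (q - 1) * M * (a - b) ^ 2 := by ring

/-! ## §4. The scale-`h` `L^q` production inequality -/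

/-- ★★ **The scale-`h` `L^q` production inequality.**  Let `u` be continuous with `δ ≤ u ≤ B` (`δ > 0`), `1 < q`, `ξ^{q−2} ≤ M`
for `ξ ∈ [δ, B]`, and `|κ_h u − u| ≤ D` pointwise, for some realising kernel family and some `h`.  Then

  `∫ (κ_h u)^q dμ_{β'} − ∫ u^q dμ_{β'} ≤ −(4(q−1)/q)·(∫ u^{q/2}u^{q/2} dμ_{β'} − ∫ u^{q/2} κ_h u^{q/2} dμ_{β'}) + q(q−1)·M·D²`

(`= −(4(q−1)/q)·h𝓔_h(u^{q/2}) + q(q−1)MD²`): the convexity step, the split `(κ_hu)^{q−1} = u^{q−1} + ((κ_hu)^{q−1} − u^{q−1})`, the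
Stroock–Varopoulos inequality at scale `h` for the first piece and the Lipschitz bound for the second.  Divided by `h` along
`u = κ_t F` (`D = O(h)`) it is the Dini form of `(d/dt)‖κ_tF‖_q^q = −q𝓔((κ_tF)^{q−1}, κ_tF) ≤ −(4(q−1)/q)𝓔((κ_tF)^{q/2})`.
[cite: DiaconisSaloffcoste1996, §2.3 Lemmas 2.5–2.6 and §3.2 proof of Theorem 3.5] -/
theorem integral_rpow_transition_sub_le_dirichletScale (L : ℕ) [NeZero L] (β' : ℝ)
    (κ : ℝ≥0 → Kernel (GaugeConfig 3 L (Matrix.specialUnitaryGroup (Fin 2) ℂ))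
      (GaugeConfig 3 L (Matrix.specialUnitaryGroup (Fin 2) ℂ))) [∀ t, IsMarkovKernel (κ t)]
    (hreal : ∀ (t : ℝ≥0) (x : GaugeConfig 3 L (Matrix.specialUnitaryGroup (Fin 2) ℂ))
        (Ω : Type) [MeasurableSpace Ω] (P : Measure Ω) [IsProbabilityMeasure P]
        (W : ℝ≥0 → Ω → (Edge 3 L × NoiseIdx 2 → ℝ)) (hW : IsFlatBrownian W P)
        (U : ℝ≥0 → Ω → GaugeConfig 3 L (Matrix.specialUnitaryGroup (Fin 2) ℂ)),
        (∀ ω, U 0 ω = x) →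
        (latticeLangevinDynamics (fundamentalLatticeRep 2) β').IsSolution (fundamentalRep (Fin 2))
          hW.natFiltration P W U →
        κ t x = P.map (U t))
    (h : ℝ≥0) {u : GaugeConfig 3 L (Matrix.specialUnitaryGroup (Fin 2) ℂ) → ℝ} (hu : Continuous u)
    {δ : ℝ} (hδ : 0 < δ) (hδu : ∀ x, δ ≤ u x) {B : ℝ} (huB : ∀ x, u x ≤ B) {q : ℝ} (hq : 1 < q)
    {M : ℝ} (hM : ∀ ξ, δ ≤ ξ → ξ ≤ B → ξ ^ (q - 2) ≤ M)
    {D : ℝ} (hD : ∀ x, |(∫ y, u y ∂(κ h x)) - u x| ≤ D) :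
    (∫ x, (∫ y, u y ∂(κ h x)) ^ q ∂(wilsonMeasure (d := 3) (L := L) (fundamentalRep (Fin 2)) β')) -
        ∫ x, u x ^ q ∂(wilsonMeasure (d := 3) (L := L) (fundamentalRep (Fin 2)) β') ≤
      -(4 * (q - 1) / q) *
          ((∫ x, u x ^ (q / 2) * u x ^ (q / 2) ∂(wilsonMeasure (d := 3) (L := L) (fundamentalRep (Fin 2)) β')) -
            ∫ x, u x ^ (q / 2) * (∫ y, u y ^ (q / 2) ∂(κ h x)) ∂(wilsonMeasure (d := 3) (L := L) (fundamentalRep (Fin 2)) β')) +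
        q * (q - 1) * M * D ^ 2 := by
  classical
  haveI := secondCountableTopology_su2
  haveI := borelSpace_config L
  set μ : Measure (GaugeConfig 3 L (Matrix.specialUnitaryGroup (Fin 2) ℂ)) :=
    wilsonMeasure (d := 3) (L := L) (fundamentalRep (Fin 2)) β' with hμ
  haveI : IsProbabilityMeasure μ :=
    isProbabilityMeasure_wilsonMeasure (d := 3) (L := L) (fundamentalRep (Fin 2)) (continuous_fundamentalRep (Fin 2)) β'
  have hpos : ∀ x, 0 < u x := fun x => lt_of_lt_of_le hδ (hδu x)
  have hq1 : 1 ≤ q := hq.le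
  have hq0 : 0 < q := by linarith
  -- `v = κ_h u`: continuous, `δ ≤ v ≤ B`
  set v : GaugeConfig 3 L (Matrix.specialUnitaryGroup (Fin 2) ℂ) → ℝ := fun x => ∫ y, u y ∂(κ h x) with hv
  have hvc : Continuous v := continuous_integral_transitionKernel L β' κ hreal h hu
  have hδv : ∀ x, δ ≤ v x := by
    intro x
    have := integral_mono (integrable_const (μ := κ h x) δ) (integrable_of_continuous_of_compactSpace hu _) fun y => hδu y
    rwa [integral_const, probReal_univ, one_smul] at this
  have hvB : ∀ x, v x ≤ B := by
    intro x
    have := integral_mono (integrable_of_continuous_of_compactSpace hu _) (integrable_const (μ := κ h x) B) fun y => huB y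
    rwa [integral_const, probReal_univ, one_smul] at this
  have hvpos : ∀ x, 0 < v x := fun x => lt_of_lt_of_le hδ (hδv x)
  -- `M ≥ 0` (the interval `[δ, B]` is non-empty)
  have hδB : δ ≤ B := (hδu (Classical.arbitrary _)).trans (huB _)
  have hM0 : 0 ≤ M := (Real.rpow_pos_of_pos hδ (q - 2)).le.trans (hM δ le_rfl hδB)
  -- convexity step
  have h1 := integral_rpow_transition_sub_le L β' κ hreal h hu hpos hq1
  -- split `v^{q−1}(v − u) = u^{q−1}(v − u) + (v − u)(v^{q−1} − u^{q−1})`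
  have hb : Continuous fun x => u x ^ (q - 1) := hu.rpow_const fun x => Or.inl (hpos x).ne'
  have hvb : Continuous fun x => v x ^ (q - 1) := hvc.rpow_const fun x => Or.inl (hvpos x).ne'
  have i1 : Integrable (fun x => u x ^ (q - 1) * (v x - u x)) μ :=
    integrable_of_continuous_of_compactSpace (hb.mul (hvc.sub hu)) _
  have i2 : Integrable (fun x => (v x - u x) * (v x ^ (q - 1) - u x ^ (q - 1))) μ :=
    integrable_of_continuous_of_compactSpace ((hvc.sub hu).mul (hvb.sub hb)) _
  have hsplit : ∫ x, v x ^ (q - 1) * (v x - u x) ∂μ =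
      (∫ x, u x ^ (q - 1) * (v x - u x) ∂μ) + ∫ x, (v x - u x) * (v x ^ (q - 1) - u x ^ (q - 1)) ∂μ := by
    rw [← integral_add i1 i2]
    refine integral_congr_ae (Eventually.of_forall fun x => ?_)
    ring
  -- first piece: `∫ u^{q−1}(v − u) = −(∫ u·u^{q−1} − ∫ u^{q−1} v) ≤ −(4(q−1)/q²)·h𝓔_h(u^{q/2})`
  have hSV := four_mul_sub_one_mul_dirichletScale_rpow_half_le L β' κ hreal h hu hpos hq
  have e2 : ∫ x, u x ^ (q - 1) * (v x - u x) ∂μ =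
      -((∫ x, u x * u x ^ (q - 1) ∂μ) - ∫ x, u x ^ (q - 1) * v x ∂μ) := by
    have ee : ∀ x, u x ^ (q - 1) * (v x - u x) = u x ^ (q - 1) * v x - u x * u x ^ (q - 1) := fun x => by ring
    simp_rw [ee]
    have ia : Integrable (fun x => u x ^ (q - 1) * v x) μ := integrable_of_continuous_of_compactSpace (hb.mul hvc) _
    have ib : Integrable (fun x => u x * u x ^ (q - 1)) μ := integrable_of_continuous_of_compactSpace (hu.mul hb) _
    rw [integral_sub ia ib]
    ring
  have hpiece1 : ∫ x, u x ^ (q - 1) * (v x - u x) ∂μ ≤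
      -(4 * (q - 1) / q ^ 2) * ((∫ x, u x ^ (q / 2) * u x ^ (q / 2) ∂μ) -
        ∫ x, u x ^ (q / 2) * (∫ y, u y ^ (q / 2) ∂(κ h x)) ∂μ) := by
    rw [e2]
    have hq2 : 0 < q ^ 2 := by positivity
    have h3 : 4 * (q - 1) / q ^ 2 * ((∫ x, u x ^ (q / 2) * u x ^ (q / 2) ∂μ) -
        ∫ x, u x ^ (q / 2) * (∫ y, u y ^ (q / 2) ∂(κ h x)) ∂μ) ≤
        (∫ x, u x * u x ^ (q - 1) ∂μ) - ∫ x, u x ^ (q - 1) * v x ∂μ := by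
      rw [div_mul_eq_mul_div, div_le_iff₀ hq2]
      linarith
    linarith
  -- second piece: `≤ (q−1) M D²`
  have hpiece2 : ∫ x, (v x - u x) * (v x ^ (q - 1) - u x ^ (q - 1)) ∂μ ≤ (q - 1) * M * D ^ 2 := by
    have hpt : ∀ x, (v x - u x) * (v x ^ (q - 1) - u x ^ (q - 1)) ≤ (q - 1) * M * D ^ 2 := by
      intro x
      have hL := sub_mul_rpow_sub_one_sub_le hq1 hδ hM (hδv x) (hvB x) (hδu x) (huB x)
      have hsq : (v x - u x) ^ 2 ≤ D ^ 2 := by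
        rw [← sq_abs (v x - u x)]
        exact pow_le_pow_left₀ (abs_nonneg _) (hD x) 2
      have hc : 0 ≤ (q - 1) * M := mul_nonneg (by linarith) hM0
      exact hL.trans (mul_le_mul_of_nonneg_left hsq hc)
    have := integral_mono i2 (integrable_const ((q - 1) * M * D ^ 2)) hpt
    rwa [integral_const, probReal_univ, one_smul] at this
  -- assemble
  have h4 : q * ∫ x, v x ^ (q - 1) * (v x - u x) ∂μ ≤
      -(4 * (q - 1) / q) * ((∫ x, u x ^ (q / 2) * u x ^ (q / 2) ∂μ) -
          ∫ x, u x ^ (q / 2) * (∫ y, u y ^ (q / 2) ∂(κ h x)) ∂μ) + q * (q - 1) * M * D ^ 2 := by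
    rw [hsplit, mul_add]
    have hA : q * ∫ x, u x ^ (q - 1) * (v x - u x) ∂μ ≤
        -(4 * (q - 1) / q) * ((∫ x, u x ^ (q / 2) * u x ^ (q / 2) ∂μ) -
          ∫ x, u x ^ (q / 2) * (∫ y, u y ^ (q / 2) ∂(κ h x)) ∂μ) := by
      have := mul_le_mul_of_nonneg_left hpiece1 hq0.le
      have e : q * (-(4 * (q - 1) / q ^ 2) * ((∫ x, u x ^ (q / 2) * u x ^ (q / 2) ∂μ) -
          ∫ x, u x ^ (q / 2) * (∫ y, u y ^ (q / 2) ∂(κ h x)) ∂μ)) =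
          -(4 * (q - 1) / q) * ((∫ x, u x ^ (q / 2) * u x ^ (q / 2) ∂μ) -
          ∫ x, u x ^ (q / 2) * (∫ y, u y ^ (q / 2) ∂(κ h x)) ∂μ) := by
        field_simp
      rw [e] at this
      exact this
    have hB' : q * ∫ x, (v x - u x) * (v x ^ (q - 1) - u x ^ (q - 1)) ∂μ ≤ q * (q - 1) * M * D ^ 2 := by
      have := mul_le_mul_of_nonneg_left hpiece2 hq0.le
      linarith
    exact add_le_add hA hB'
  exact h1.trans h4

end Summit.QuantumFields.YangMills.Theorems.ColdStartUniversality

end
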